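import Summits.ValiantsHypothesis.ValiantsHypothesis.Theorems.LacunarySymmetroidMatrixDescartesCensusV19TCheck
import Summits.ValiantsHypothesis.ValiantsHypothesis.Theorems.LacunarySymmetroidMatrixDescartesCensusV19GSoundCerts

/-!
# `MatrixDescartes` census — soundness of the `V19T` certificates: hypothesis rows, Farkas products, LP, domination, signs, split trees

HONEST FRAMING.  Object-search cell `pub-symmetroid`; door-A item `DoorA26 = PosRootLawAt 2 6 19` (stmt-ValiantsHypothesis-19979; OPEN, typed,
never asserted).  PROOFS, no new definitions (val-sym-door-p4 g6): no `V19G.Model` whose values satisfy the hypothesis rows `H` passes a certificate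
accepted by `V19T.certOK c H` (`…CensusV19TCheck`); in particular (`H = []`) none passes `V19T.topOK`.  The leaf layer is val-sym-door-p5 g5's
`…CensusV19GSoundCerts` TRANSCRIBED for the row type `V19T.TRow` (a `V19G` row is sound by `V19G.buildRow_sound`, a hypothesis row holds by
hypothesis): the accumulated Farkas product is `V20.accumulate` with `V20.accumulate_spec`; an accepted `lp` is contradictory; an accepted competitor
bounds its positive term; an accepted `dom` is contradictory; the `sign` / `signNull` / `allneg` leaves are `V19S`'s.  The SPLIT node is sound by
`le_total` on the two sides of its row (positive reals): the model satisfies the row or the swapped row, so one subtree's hypotheses all hold.  The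
middle-window disjunction at the top is `V19G.Model.branch`.  Nothing here bears on the one-collision supports, on `ζ_sym(2,6)` over all supports,
on `DoorA26` itself, on `MatrixDescartes` (stmt-ValiantsHypothesis-18050) or on `VP ≠ VNP`.

[folklore] Certificate-checker soundness; elementary.
-/

-- the D-0017 layout repeats a namespace component (single-conjunct summit); the `dupNamespace` linter flags it; name mandated.
set_option linter.dupNamespace false

namespace Summit.ValiantsHypothesis.ValiantsHypothesis.Theorems.LacunarySymmetroidMatrixDescartes.Census.V19T

open V20 (Atom allAtoms posOf qA cA Term PolySpec posl FNat fval Row FRat bumps mulF divF numZ denZ tval pval lprod xpow xpowAux frval BPos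
  lprod_pos atoms_valid coeff_ne_zero term_getD_mem fval_singleton xpow_bumps xpowAux_replicate_zero frval_nil frval_mulF frval_divF
  frval_eq_numZ_div_denZ zero21 accumulate accumulate_spec accumulate_eq_foldl pval_eq_sum_range)
open V19S (Ctx Mode mkCtx termZero termNeg posTerms defOK abs_tval_eq posl_lt_21 lt_length_of_mem_posTerms mem_posTerms_iff
  tval_nonpos_of_not_pos pval_nonneg signOK_sound signNullOK_sound allnegOK_sound)

section Certs

open Finset

variable {c : Ctx} {x : ℕ → ℝ} {v : Atom → ℝ}

/-! ### Rows under hypotheses -/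

/-- A well-formedness check passes only on well-formed rows. [folklore] -/
theorem rowWF_spec {r : Row} (h : rowWF r = true) : r.WF := by
  unfold rowWF at h
  simp only [Bool.and_eq_true, List.all_eq_true, decide_eq_true_eq] at h
  obtain ⟨⟨⟨hL, hR⟩, hn⟩, hd⟩ := h
  exact ⟨hL, hR, hn, hd⟩

/-- The swapped row of a well-formed row is well formed. [folklore] -/
theorem swapRow_WF {r : Row} (h : r.WF) : (swapRow r).WF := by
  obtain ⟨hL, hR, hn, hd⟩ := h
  exact ⟨hR, hL, hd, hn⟩

/-- A resolved row reference holds and is well formed: `V19G` rows by `V19G.buildRow_sound`, hypothesis rows by hypothesis. [folklore] -/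
theorem buildRow_sound (M : V19G.Model c x v) {H : List Row} (HH : ∀ r ∈ H, Row.Holds x r ∧ r.WF) {rs : TRow} {r : Row}
    (h : buildRow c H rs = some r) : Row.Holds x r ∧ r.WF := by
  cases rs with
  | g gr =>
    simp only [buildRow] at h
    exact V19G.buildRow_sound M h
  | hyp i =>
    simp only [buildRow] at h
    exact HH r (List.mem_of_getElem? h)

/-- All resolved rows hold and are well formed. [folklore] -/
theorem buildRows_sound (M : V19G.Model c x v) {H : List Row} (HH : ∀ r ∈ H, Row.Holds x r ∧ r.WF) :
    ∀ (specs : List (TRow × ℕ)) (rs : List (Row × ℕ)), buildRows c H specs = some rs →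
      ∀ rn ∈ rs, Row.Holds x rn.1 ∧ rn.1.WF
  | [], rs, h => by simp [buildRows] at h; subst h; simp
  | (sp, n) :: specs, rs, h => by
    simp only [buildRows] at h
    split at h
    · next r rr hr hrr =>
      cases h
      intro rn hrn
      simp only [List.mem_cons] at hrn
      rcases hrn with rfl | hrn
      · exact buildRow_sound M HH hr
      · exact buildRows_sound M HH specs rr hrr rn hrn
    · cases h

/-- The Farkas product of resolved rows: monomial parts and the constant ratio. [folklore] -/
theorem accumulate_sound (M : V19G.Model c x v) {H : List Row} (HH : ∀ r ∈ H, Row.Holds x r ∧ r.WF) {specs : List (TRow × ℕ)}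
    {rs : List (Row × ℕ)} (h : buildRows c H specs = some rs) :
    (accumulate rs).1.length = 21 ∧ (accumulate rs).2.1.length = 21 ∧ BPos (accumulate rs).2.2 ∧
      ∃ PL PR Cd Cn : ℝ, 0 < PL ∧ 0 < Cn ∧ 0 < Cd ∧
        xpow x (accumulate rs).1 = PL ∧ xpow x (accumulate rs).2.1 = PR ∧
        frval (accumulate rs).2.2 = Cd / Cn ∧ PL * Cd ≤ PR * Cn := by
  have := accumulate_spec M.base.xpos rs (buildRows_sound M HH specs rs h) (zero21, zero21, [])
    (by simp [zero21]) (by simp [zero21]) (by intro bz h; simp at h)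
  rw [accumulate_eq_foldl]
  obtain ⟨r1, r2, r3, PL, PR, Cd, Cn, hPL, hCn, hCd, e1, e2, e3, hle⟩ := this
  refine ⟨r1, r2, r3, PL, PR, Cd, Cn, hPL, hCn, hCd, ?_, ?_, ?_, hle⟩
  · rw [e1, show xpow x (zero21, zero21, ([] : FRat)).1 = 1 from xpowAux_replicate_zero x 21 0, one_mul]
  · rw [e2, show xpow x (zero21, zero21, ([] : FRat)).2.1 = 1 from xpowAux_replicate_zero x 21 0, one_mul]
  · rw [e3, show frval (zero21, zero21, ([] : FRat)).2.2 = 1 from frval_nil, one_mul]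

/-! ### LP certificates -/

/-- An accepted Farkas certificate under valid hypotheses refutes the model. [folklore] -/
theorem lpOK_sound (M : V19G.Model c x v) {H : List Row} (HH : ∀ r ∈ H, Row.Holds x r ∧ r.WF) {specs : List (TRow × ℕ)}
    (h : lpOK c H specs = true) : False := by
  unfold lpOK at h
  split at h
  · simp at h
  · next rs hrs =>
    simp only [Bool.and_eq_true, decide_eq_true_eq] at h
    obtain ⟨hbal, hlt⟩ := h
    obtain ⟨-, -, hB, PL, PR, Cd, Cn, hPL, hCn, hCd, e1, e2, e3, hle⟩ := accumulate_sound M HH hrs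
    have hPLR : PL = PR := by rw [← e1, ← e2, hbal]
    have hratio : Cd ≤ Cn := le_of_mul_le_mul_left (a := PL) (by rw [hPLR] at hle ⊢; exact hle) hPL
    obtain ⟨hf, hden⟩ := frval_eq_numZ_div_denZ hB
    rw [e3] at hf
    have hdenR : (0 : ℝ) < denZ (accumulate rs).2.2 := by exact_mod_cast hden
    have h1 : Cd / Cn ≤ 1 := (div_le_one hCn).2 hratio
    rw [hf] at h1
    have h2 : (numZ (accumulate rs).2.2 : ℝ) ≤ denZ (accumulate rs).2.2 := by
      rwa [div_le_one hdenR] at h1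
    have h3 : numZ (accumulate rs).2.2 ≤ denZ (accumulate rs).2.2 := by exact_mod_cast h2
    omega

/-! ### Domination certificates -/

/-- One competitor under valid hypotheses: the bound `|t_k| · ud ≤ un · |t₀|`. [folklore] -/
theorem compOK_sound (M : V19G.Model c x v) {H : List Row} (HH : ∀ r ∈ H, Row.Holds x r ∧ r.WF) {P : PolySpec} (hval : P.valid = true)
    {n0 ud : ℕ} (hn0 : n0 < P.poly.length) (hz0 : termZero c (P.poly.getD n0 (0, [])) = false) (hud : 0 < ud) {cp : Comp}
    (hk : cp.k < P.poly.length) (hzk : termZero c (P.poly.getD cp.k (0, [])) = false)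
    (h : compOK c H P.poly n0 ud cp = true) :
    |tval v (P.poly.getD cp.k (0, []))| * ud ≤ cp.un * |tval v (P.poly.getD n0 (0, []))| := by
  unfold compOK at h
  split at h
  · simp at h
  · next rs hrs =>
    simp only [Bool.and_eq_true, decide_eq_true_eq] at h
    obtain ⟨⟨⟨hD, hun⟩, hbal⟩, hle⟩ := h
    obtain ⟨hl1, hl2, hB, PL, PR, Cd, Cn, hPL, hCn, hCd, e1, e2, e3, hrow⟩ := accumulate_sound M HH hrs
    have hT0a := atoms_valid P hval _ (term_getD_mem P.poly hn0)
    have hTka := atoms_valid P hval _ (term_getD_mem P.poly hk)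
    have hg0 : (P.poly.getD n0 (0, [])).1 ≠ 0 := coeff_ne_zero P _ (term_getD_mem P.poly hn0)
    have hgk : (P.poly.getD cp.k (0, [])).1 ≠ 0 := coeff_ne_zero P _ (term_getD_mem P.poly hk)
    rw [abs_tval_eq M.base _ hT0a hz0, abs_tval_eq M.base _ hTka hzk]
    set G0 : ℝ := |((P.poly.getD n0 (0, [])).1 : ℝ)| with hG0
    set Gk : ℝ := |((P.poly.getD cp.k (0, [])).1 : ℝ)| with hGk
    set m0 := lprod x (posl c.ord (P.poly.getD n0 (0, [])).2) with hm0
    set mk := lprod x (posl c.ord (P.poly.getD cp.k (0, [])).2) with hmk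
    have hm0p : 0 < m0 := lprod_pos M.base.xpos _
    have hmkp : 0 < mk := lprod_pos M.base.xpos _
    have hG0p : 0 < G0 := by rw [hG0]; exact abs_pos.2 (by exact_mod_cast hg0)
    have hGkp : 0 < Gk := by rw [hGk]; exact abs_pos.2 (by exact_mod_cast hgk)
    have hudR : (0 : ℝ) < ud := by exact_mod_cast hud
    have hunR : (0 : ℝ) < cp.un := by exact_mod_cast hun
    have hbal' : PL * m0 ^ cp.D = PR * mk ^ cp.D := by
      have h1 := xpow_bumps x (accumulate rs).1 (posl c.ord (P.poly.getD n0 (0, [])).2) cp.D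
        (fun p hp => by rw [hl1]; exact posl_lt_21 M.base hT0a p hp)
      have h2 := xpow_bumps x (accumulate rs).2.1 (posl c.ord (P.poly.getD cp.k (0, [])).2) cp.D
        (fun p hp => by rw [hl2]; exact posl_lt_21 M.base hTka p hp)
      rw [← e1, ← e2, ← h1, ← h2, hbal]
    have hb1 : ∀ be ∈ [(cp.un * (P.poly.getD n0 (0, [])).1.natAbs, cp.D)], 0 < be.1 := by
      intro be hbe; simp only [List.mem_singleton] at hbe; subst hbe
      exact Nat.mul_pos hun (Int.natAbs_pos.2 hg0)
    have hb2 : ∀ be ∈ [((P.poly.getD cp.k (0, [])).1.natAbs * ud, cp.D)], 0 < be.1 := by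
      intro be hbe; simp only [List.mem_singleton] at hbe; subst hbe
      exact Nat.mul_pos (Int.natAbs_pos.2 hgk) hud
    have hm := frval_mulF hb1 1 hB
    have hd := frval_divF hb2 1 hm.2
    obtain ⟨hf, hden⟩ := frval_eq_numZ_div_denZ hd.2
    have hdenR : (0 : ℝ) < denZ (divF (mulF (accumulate rs).2.2 [(cp.un * (P.poly.getD n0 (0, [])).1.natAbs, cp.D)] 1)
        [((P.poly.getD cp.k (0, [])).1.natAbs * ud, cp.D)] 1) := by exact_mod_cast hden
    have hge : (1 : ℝ) ≤ frval (divF (mulF (accumulate rs).2.2 [(cp.un * (P.poly.getD n0 (0, [])).1.natAbs, cp.D)] 1)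
        [((P.poly.getD cp.k (0, [])).1.natAbs * ud, cp.D)] 1) := by
      rw [hf, le_div_iff₀ hdenR, one_mul]; exact_mod_cast hle
    rw [hd.1, hm.1, e3, fval_singleton, fval_singleton, pow_one, pow_one] at hge
    push_cast at hge
    rw [Nat.cast_natAbs, Int.cast_abs, Nat.cast_natAbs, Int.cast_abs] at hge
    have hX : 0 < (Gk * ud) ^ cp.D := by positivity
    have hi : Cn * (Gk * ud) ^ cp.D ≤ Cd * (cp.un * G0) ^ cp.D := by
      have := hge
      rw [le_div_iff₀ hX, one_mul, div_mul_eq_mul_div, le_div_iff₀ hCn] at this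
      linarith
    have hii : PL * (Gk * ud) ^ cp.D ≤ PR * (cp.un * G0) ^ cp.D := by
      have h1 : PL * (Cn * (Gk * ud) ^ cp.D) ≤ PL * (Cd * (cp.un * G0) ^ cp.D) := mul_le_mul_of_nonneg_left hi hPL.le
      have h2 : PL * Cd * (cp.un * G0) ^ cp.D ≤ PR * Cn * (cp.un * G0) ^ cp.D :=
        mul_le_mul_of_nonneg_right hrow (by positivity)
      nlinarith
    have hiii : (mk * Gk * ud) ^ cp.D ≤ (m0 * cp.un * G0) ^ cp.D := by
      have h1 : PL * mk ^ cp.D * (Gk * ud) ^ cp.D ≤ PR * mk ^ cp.D * (cp.un * G0) ^ cp.D := by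
        nlinarith [pow_pos hmkp cp.D]
      rw [show PR * mk ^ cp.D = PL * m0 ^ cp.D from hbal'.symm] at h1
      have h1' : PL * (mk ^ cp.D * (Gk * ud) ^ cp.D) ≤ PL * (m0 ^ cp.D * (cp.un * G0) ^ cp.D) := by linarith
      have h2 : mk ^ cp.D * (Gk * ud) ^ cp.D ≤ m0 ^ cp.D * (cp.un * G0) ^ cp.D := le_of_mul_le_mul_left h1' hPL
      simp only [mul_pow] at h2 ⊢
      linarith
    have hfin : mk * Gk * ud ≤ m0 * cp.un * G0 :=
      (pow_le_pow_iff_left₀ (by positivity) (by positivity) (by omega)).1 hiii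
    nlinarith

/-- An accepted domination certificate under valid hypotheses refutes the model. [folklore] -/
theorem domOK_sound (M : V19G.Model c x v) {H : List Row} (HH : ∀ r ∈ H, Row.Holds x r ∧ r.WF) {P : PolySpec} {n0 ud : ℕ}
    {comps : List Comp} (h : domOK c H P n0 ud comps = true) : False := by
  classical
  unfold domOK at h
  simp only [Bool.and_eq_true, decide_eq_true_eq, List.all_eq_true, Bool.not_eq_true'] at h
  obtain ⟨⟨⟨⟨⟨⟨⟨⟨⟨⟨hval, hdef⟩, hn0⟩, hz0⟩, hneg⟩, hud⟩, hcov⟩, hpos⟩, hnd⟩, hsum⟩, hall⟩ := h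
  have hP : 0 ≤ pval v P.poly := by
    refine pval_nonneg M.base P hval fun i j hij => ?_
    subst hij; simpa [defOK] using hdef
  set w : ℕ → ℝ := fun n => tval v (P.poly.getD n (0, [])) with hw
  have hT0a := atoms_valid P hval _ (term_getD_mem P.poly hn0)
  have hg0 : (P.poly.getD n0 (0, [])).1 ≠ 0 := coeff_ne_zero P _ (term_getD_mem P.poly hn0)
  have hw0 : 0 < |w n0| := by
    rw [hw]; simp only
    rw [abs_tval_eq M.base _ hT0a hz0]
    exact mul_pos (abs_pos.2 (by exact_mod_cast hg0)) (lprod_pos M.base.xpos _)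
  have hklt : ∀ cp ∈ comps, cp.k < P.poly.length := fun cp hcp => lt_length_of_mem_posTerms (hpos cp hcp)
  have hkz : ∀ cp ∈ comps, termZero c (P.poly.getD cp.k (0, [])) = false := fun cp hcp =>
    ((mem_posTerms_iff (hklt cp hcp)).1 (hpos cp hcp)).1
  have hbounds : (comps.map fun cp => |w cp.k| * ud).sum ≤ (comps.map fun cp => (cp.un : ℝ) * |w n0|).sum :=
    List.sum_le_sum fun cp hcp => compOK_sound M HH hval hn0 hz0 hud (hklt cp hcp) (hkz cp hcp) (hall cp hcp)
  have hsumR : ((comps.map Comp.un).sum : ℝ) < ud := by exact_mod_cast hsum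
  have hlt : (comps.map fun cp => |w cp.k|).sum < |w n0| := by
    have e1 : (comps.map fun cp => |w cp.k| * ud).sum = (comps.map fun cp => |w cp.k|).sum * ud := by
      rw [List.sum_map_mul_right]
    have e2 : (comps.map fun cp => (cp.un : ℝ) * |w n0|).sum = ((comps.map Comp.un).sum : ℝ) * |w n0| := by
      push_cast
      rw [List.map_map, ← List.sum_map_mul_right]
      rfl
    rw [e1, e2] at hbounds
    have hudR : (0 : ℝ) < ud := by exact_mod_cast hud
    nlinarith
  set posS := (posTerms c P.poly).toFinset with hposS
  have hposSub : posS ⊆ Finset.range P.poly.length := by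
    intro n hn
    rw [hposS, List.mem_toFinset] at hn
    exact Finset.mem_range.2 (lt_length_of_mem_posTerms hn)
  have hrest : ∀ n ∈ Finset.range P.poly.length \ posS, w n ≤ 0 := by
    intro n hn
    rw [Finset.mem_sdiff, Finset.mem_range, hposS, List.mem_toFinset] at hn
    have hnp : ¬ (termZero c (P.poly.getD n (0, [])) = false ∧ termNeg c (P.poly.getD n (0, [])) = false) :=
      fun hh => hn.2 ((mem_posTerms_iff hn.1).2 hh)
    exact tval_nonpos_of_not_pos M.base _ (atoms_valid P hval _ (term_getD_mem P.poly hn.1)) hnp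
  have hn0rest : n0 ∈ Finset.range P.poly.length \ posS := by
    rw [Finset.mem_sdiff, Finset.mem_range, hposS, List.mem_toFinset]
    refine ⟨hn0, fun hmem => ?_⟩
    have := ((mem_posTerms_iff hn0).1 hmem).2
    rw [this] at hneg
    exact Bool.false_ne_true hneg
  have hsplit : pval v P.poly = ∑ n ∈ posS, w n + ∑ n ∈ Finset.range P.poly.length \ posS, w n := by
    rw [pval_eq_sum_range, ← Finset.sum_sdiff hposSub, add_comm]
  have hrestle : ∑ n ∈ Finset.range P.poly.length \ posS, w n ≤ w n0 := by
    rw [← Finset.add_sum_erase _ _ hn0rest]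
    have : ∑ n ∈ (Finset.range P.poly.length \ posS).erase n0, w n ≤ 0 :=
      Finset.sum_nonpos fun n hn => hrest n (Finset.mem_of_mem_erase hn)
    linarith
  have hposle : ∑ n ∈ posS, w n ≤ (comps.map fun cp => |w cp.k|).sum := by
    have hsub2 : posS ⊆ (comps.map Comp.k).toFinset := by
      intro n hn
      rw [hposS, List.mem_toFinset] at hn
      obtain ⟨cp, hcp, hck⟩ := hcov n hn
      rw [List.mem_toFinset, List.mem_map]
      exact ⟨cp, hcp, hck⟩
    calc ∑ n ∈ posS, w n ≤ ∑ n ∈ posS, |w n| := Finset.sum_le_sum fun n _ => le_abs_self _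
      _ ≤ ∑ n ∈ (comps.map Comp.k).toFinset, |w n| :=
          Finset.sum_le_sum_of_subset_of_nonneg hsub2 fun n _ _ => abs_nonneg _
      _ = ((comps.map Comp.k).map fun n => |w n|).sum := List.sum_toFinset _ hnd
      _ = (comps.map fun cp => |w cp.k|).sum := by rw [List.map_map]; rfl
  have hw0le : w n0 ≤ 0 := hrest n0 hn0rest
  have : |w n0| = -w n0 := abs_of_nonpos hw0le
  linarith

/-! ### Leaves and split trees -/

/-- **Soundness of the leaf certificates under hypotheses**: no `V19G` model satisfying `H` passes an accepted leaf. [folklore] -/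
theorem cert0OK_sound (M : V19G.Model c x v) {H : List Row} (HH : ∀ r ∈ H, Row.Holds x r ∧ r.WF) {ct : Cert0}
    (h : cert0OK c H ct = true) : False := by
  cases ct with
  | sign i j k => exact signOK_sound M.base h
  | signNull n a b => exact signNullOK_sound M.base h
  | allneg P => exact allnegOK_sound M.base h
  | lp rows => exact lpOK_sound M HH h
  | dom P n0 ud comps => exact domOK_sound M HH h

/-- **Soundness of the split trees**: no `V19G` model satisfying the hypotheses `H` passes a tree accepted by `certOK c H` — a leaf directly,
a split through the half of the dichotomy the model falls in (`le_total`). [folklore] -/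
theorem certOK_sound (M : V19G.Model c x v) :
    ∀ (t : Cert) (H : List Row), (∀ r ∈ H, Row.Holds x r ∧ r.WF) → certOK c H t = true → False
  | .leaf ct, H, HH, h => by
    simp only [certOK] at h
    exact cert0OK_sound M HH h
  | .split r c1 c2, H, HH, h => by
    simp only [certOK, Bool.and_eq_true] at h
    obtain ⟨⟨hwf, h1⟩, h2⟩ := h
    have hW := rowWF_spec hwf
    rcases le_total (lprod x r.L * (fval r.Bden : ℝ)) (lprod x r.R * (fval r.Bnum : ℝ)) with hle | hle
    · refine certOK_sound M c1 (H ++ [r]) (fun r' hr' => ?_) h1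
      rw [List.mem_append, List.mem_singleton] at hr'
      rcases hr' with hr' | rfl
      · exact HH r' hr'
      · exact ⟨hle, hW⟩
    · refine certOK_sound M c2 (H ++ [swapRow r]) (fun r' hr' => ?_) h2
      rw [List.mem_append, List.mem_singleton] at hr'
      rcases hr' with hr' | rfl
      · exact HH r' hr'
      · exact ⟨hle, swapRow_WF hW⟩

/-- **Soundness of the `V19T` certificate checker (abstract form)**: no `V19G` model passes an accepted top-level certificate — a split tree
from the empty hypothesis list, a `branch2` through the branch the model falls in (`V19G.Model.branch`). [folklore] -/
theorem topOK_sound (M : V19G.Model c x v) {ct : Top} (h : topOK c ct = true) : False := by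
  cases ct with
  | node t =>
    simp only [topOK] at h
    exact certOK_sound M t [] (fun r hr => by simp at hr) h
  | branch2 tK tK1 =>
    obtain ⟨d, ord, E, s, mode, mid⟩ := c
    cases mode with
    | B z => simp [topOK] at h
    | A k =>
      simp only [topOK, Bool.and_eq_true, decide_eq_true_eq] at h
      obtain ⟨⟨⟨h1, h2⟩, hK⟩, hK1⟩ := h
      rcases M.branch rfl h1 h2 with M' | M'
      · exact certOK_sound M' tK [] (fun r hr => by simp at hr) hK
      · exact certOK_sound M' tK1 [] (fun r hr => by simp at hr) hK1

end Certs

end Summit.ValiantsHypothesis.ValiantsHypothesis.Theorems.LacunarySymmetroidMatrixDescartes.Census.V19T
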